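import Summits.QuantumFields.BalabanUV.Beta.GAN24.T2UndressedCombDriftRows
import Summits.QuantumFields.BalabanUV.Beta.GAN24.T2UndressedCombShapeEnd

/-!
# `BalabanUV.Beta.GAN24.T2UndressedCombDriftEnd` — binder row G-an2-4 ∕ (CONV-C), CT-W: **ROW (U-drift): «T2Drift» OF THE UNDRESSED-KERNEL COMB-SLOT REFERENCE TOWER
# FROM F2a-comb AND THE EXACT PIN ALONE** (`d = 3`, `2 ≤ Lc`, any in-block root, `cE = Lc⁴`, `cE₂ = +Lc⁸`, every `cVH cΛ cB Tc`, every off-diagonal covariant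
# `LocStencil₂` border) — road W3's END #2 `TransportRows.rate_three_of_rows_F3b` at `D_n := T_{n+1} − T_n` with EVERY row discharged by name down to (B)'s letter

NOT IN PRINT; OUR PROOF ATTEMPT (G-an2-4 formalisation swarm, leaf prover `b2b-balaban-gan24-formalise-leaf-04` gen 59, crux team (2); the OWNER gan24-p1 g23's
word l.38063 (c) «(U-drift) = W3's END #2 at YOUR reference tower (B) — natural next twin: `t2Drift_undressedComb_three_of_F2a` via `TransportRows.rate_three_of_rows_F3b` +
(A)'s `source_cauchy_of_rows` + W3's forcing zero modes at the comb slot»; RULING R-gan24p1-g23-3 (v); R6 «every transport estimate must be an UNDRESSED one»; names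
PROVISIONAL).  HONEST FRAMING (cell contract, verbatim): «discharging `BetaPertH` makes Bałaban's UV stability UNCONDITIONAL — a real constructive-QFT result; it is
NOT the continuum limit and NOT the Clay problem.»  HONEST DEPENDENCY (verbatim): «continuum YM on T⁴ ⇐ BetaPertH ∧ nine spine estimates (0/9 proved); BetaPertH ⇐
(D1) ∧ (D4) ∧ CAP+tail; G-an2-4 gates asym, D1 and NE2/3/4.»

WHAT ([folklore] composition BY NAME; 0 `def`, 0 cite, 0 `def … : Prop`, 0 sorry).  `T_j := unitS₂_j (T2RecOf 3 Lc (KInvStep Lc ·) (SpureRecAt 3 Lc (toSite r) cE cVH cΛ)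
(M1At 3 Lc (toSite r) cΛ) cE₂ cB Tc vh₂S (mixFFAt (toSite r) Lc) j)`.  §1 **`t2Drift_undressedComb_three_of_F2a_pinEq`**: F2a-comb `hZ` ((B) `T2UndressedCombShapeEnd`'s binder,
token for token) ∧ `hpinEq : cE₂ = (Lc:ℝ)^(2*(3+1))` ⟹ ONE-STEP form `∀ n, LocStencil₂ (T_{n+1} − T_n) (c·ϑ^n) δ` (`0 ≤ c`, `0 < ϑ < 1`, `0 < δ`), CAUCHY form
`∀ k j, LocStencil₂ (T_{k+j} − T_k) (c·(1−ϑ)⁻¹·ϑ^k) δ`, ENTRYWISE sup-rate.  Rows: (F1b) `hsplit` = gan24-p2's `T2RecOfUnitSplit.unitS₂_T2RecOf_sub_eq_transport_add_sum` at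
`G := KInvStep` (step data ∕ bounds by his `step_data_of_letters` ∕ `bdd₄_unitS₂_T2RecOf_of_letters`); (F3b) inside `rate_three_of_rows_F3b` (road P1's
`KSlotAssembly.convCKWall_holds`); (F4b) `hf` = `T2UndressedCombDriftRows.hf_of_shapes` ∘ (B)'s «T2Shape» `t2Shape_undressedComb_three_of_F2a` ∘ (B) §0's source
Cauchy row ∘ `convCKWall_holds`; (F2b) `hZf` = `T2UndressedCombDriftRows.hZf_of_hZ`; (F4d) `h0` from (B)'s «T2Shape» at `j = 0, 1`, `hZ0` = `T2UndressedCombChargeStep.hZ0_symZ_of_pinEq`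
(F2a-comb at m = 0 + the exact pin); Cauchy ∕ sup by the OWNER's `WSlotT2OfPieces.cauchy_of_rate` ∕ `sup_of_locStencil₂`; `exists_hU_three_of_F2a_pinEq` = the OWNER's `drift_of_dev_rows` binders
`(hU)(hcU)(hϑU0)(hϑU1)(hδU)` at `T := fun n ↦ T_n`, literally.  §2 **`t2Drift_undressedComb_literal_of_F2a`** —
road FP's literal data (`ρ_c`, `(cE, cVH, cΛ, cE₂, cB) = (Lc⁴, −Lc⁸∕2, 2∕Lc⁴, Lc⁸, −Lc¹²∕4)` — the exact pin MET, `Tc := (8N²)⁻¹ • wsym22 N`, `vh₂S := vh₂SAn1 Lc`, odd `Lc`):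
from F2a-comb ALONE (K-P's `locStencil₂_vh₂SAn1` ∕ `vh₂SAn1_translate` ∕ `vh₂SAn1_inl_inl` ∕ `_inr_inr`).  This is the `hU` binder of the OWNER's generic
`T2DeviationDrift.drift_of_dev_rows` for the reference tower of leaf-01 g62's R-leaf01-g62-2 splitting (`A := 𝒜^B`), modulo F2a-comb.  Discharges NOTHING of «T2Shape»(E)
∕ «T2Drift»(E) ∕ (hW, hWall) of the DRESSED family; NEVER «G-an2-4 closed» as (CONV-C); NOT D1, NOT `BetaPertH`, NOT continuum, NOT Clay; not in print.  2026-08-22.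
-/

noncomputable section

open Finset
open scoped BigOperators
open Literature.MathematicalPhysics.QuantumFieldTheory
open Literature.MathematicalPhysics.QuantumFieldTheory.Balaban1983to89
open Literature.MathematicalPhysics.QuantumFieldTheory.Balaban1983to89.Beta
open ExpKernelCalculus (MKer Decays shiftK)
open OneStepResolventKernel (Fib LocStencil)
open OneStepKernelFamily (KInvStep decays_KInvStep)
open AffineAveraging (box toSite)
open AveragingContoursRooted (ctrOff ctrOff_mem_box)
open AveragingMixedJetTables (mixFFAt)
open WilsonVertex2Sym (wsym22)
open SecondOrderResponse (W2SymOfK)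
open BalabanCompositeJets (LocStencil₂)
open BalabanStepJetsSucc (mmRead)
open BalabanStepW2 (K3OfK M2Of)
open Summit.QuantumFields.BalabanUV.Beta.HessKerDressedUnits (unitK unitS)
open Summit.QuantumFields.BalabanUV.Beta.SecondOrderUnits (unitM unitS₂ unitM₂)
open Summit.QuantumFields.BalabanUV.Beta.SpineRooted (T2RecOf SpureRecAt M1At locStencil_SpureRecAt vertexFamily_M1At)
open Summit.QuantumFields.BalabanUV.Beta.MixedJetTablesPlug (hmix_an1)
open Summit.QuantumFields.BalabanUV.Beta.SecondOrderSocketIdentification (vh₂SAn1 vh₂SAn1_inl_inl vh₂SAn1_inr_inr)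
open Summit.QuantumFields.BalabanUV.Beta.SecondOrderTableLawEnd (locStencil₂_vh₂SAn1 vh₂SAn1_translate)
open Summit.QuantumFields.BalabanUV.Beta.GAN24.CombesThomas (sfStep smStep)
open Summit.QuantumFields.BalabanUV.Beta.GAN24.T2RecursionAffine (lin4)
open Summit.QuantumFields.BalabanUV.Beta.GAN24.AffineUnroll (transport)
open Summit.QuantumFields.BalabanUV.Beta.GAN24.BiStencilZeroMode (Tab zmode)
open Summit.QuantumFields.BalabanUV.Beta.GAN24.WSlotForcingZeroMode (locStencil₂_sub)
open Summit.QuantumFields.BalabanUV.Beta.GAN24.WSlotT2OfPieces (cauchy_of_rate sup_of_locStencil₂)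
open Summit.QuantumFields.BalabanUV.Beta.GAN24.TransportRows (rate_three_of_rows_F3b)
open Summit.QuantumFields.BalabanUV.Beta.GAN24.KSlotAssembly (convCKWall_holds)
open Summit.QuantumFields.BalabanUV.Beta.GAN24.T2RecOfUnitSplit (unitS₂_T2RecOf_sub_eq_transport_add_sum step_data_of_letters bdd₄_unitS₂_T2RecOf_of_letters)
open Summit.QuantumFields.BalabanUV.Beta.GAN24.T2UndressedCombShapeEnd (source_rows_three_holds t2Shape_undressedComb_three_of_F2a)
open Summit.QuantumFields.BalabanUV.Beta.GAN24.T2UndressedCombChargeStep (hZ0_symZ_of_pinEq)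
open Summit.QuantumFields.BalabanUV.Beta.GAN24.T2UndressedCombDriftRows (hZf_of_hZ hf_of_shapes)

namespace Summit.QuantumFields.BalabanUV.Beta.GAN24.T2UndressedCombDriftEnd

variable {Lc : ℕ} [NeZero Lc] {r : Fin (3 + 1) → ℕ}

/-! ## §1 «T2Drift» of the reference tower ⟸ F2a-comb ∧ the exact pin (`d = 3`, any in-block root) -/

/-- NOT IN PRINT; OUR PROOF ATTEMPT — **ROW (U-drift): «T2Drift» OF THE UNDRESSED-KERNEL COMB-SLOT TOWER** ([folklore] composition BY NAME; TWO letters: F2a-comb `hZ` —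
(B)'s binder, joint `Lc`-covariance ∧ bond-symmetrised ff zero mode ZERO of every source `b_i` — and the EXACT pin `hpinEq : cE₂ = +Lc⁸`).  `2 ≤ Lc`, in-block root `r`,
`cE = Lc⁴`, every `cVH cΛ cB Tc`, off-diagonal covariant border `vh₂S` with a `LocStencil₂` shape.  Conclusion = road W3's «T2Drift» text: one-step geometric rate ∧
Cauchy form ∧ entrywise sup-rate of `T_{n+1} − T_n`.  Road W3's END #2 `TransportRows.rate_three_of_rows_F3b` with `hsplit` := p2's `unitS₂_T2RecOf_sub_eq_transport_add_sum`,
`hf` := `hf_of_shapes` ∘ (B) ∘ `convCKWall_holds`, `hZf` := `hZf_of_hZ`, `h0` := (B) at `j = 0, 1`, `hZ0` := `hZ0_symZ_of_pinEq`; `mom := 0`. -/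
theorem t2Drift_undressedComb_three_of_F2a_pinEq (hLc : 2 ≤ Lc) (hr : r ∈ box (3 + 1) Lc) {cE : ℝ} (hcE : cE = (Lc : ℝ) ^ (3 + 1)) (cVH cΛ cE₂ cB : ℝ)
    (Tc : Fin 4 → Fin 4 → Fin 4 → Fin 4 → ℝ) {vh₂S : Tab 3}
    (hBff : ∀ κ u κ' u' x z (α β : Fin (3 + 1)), vh₂S κ u κ' u' x z (Sum.inl α) (Sum.inl β) = 0)
    (hBmm : ∀ κ u κ' u' x z (μ ν : Fin (3 + 1)), vh₂S κ u κ' u' x z (Sum.inr μ) (Sum.inr ν) = 0)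
    {CB δB : ℝ} (hB : LocStencil₂ vh₂S CB δB) (hδB : 0 < δB)
    (hBt : ∀ (κ : Fin (3 + 1)) (u : Fin (3 + 1) → ℤ) (κ' : Fin (3 + 1)) (u' t : Fin (3 + 1) → ℤ),
      vh₂S κ (u + (Lc : ℤ) • t) κ' (u' + (Lc : ℤ) • t) = shiftK (-((Lc : ℤ) • t)) (vh₂S κ u κ' u'))
    (hpinEq : cE₂ = (Lc : ℝ) ^ (2 * (3 + 1)))
    (hZ : ∀ i : ℕ,
      (∀ κ u κ' u' t,
          (cE₂ * (Lc : ℝ) ^ (2 * (3 + 1))) • mmRead Lc (K3OfK (unitK (sfStep Lc i) (smStep 3 Lc i) (KInvStep (d := 3) Lc i)) Lc (unitS (sfStep Lc i) (smStep 3 Lc i) (SpureRecAt 3 Lc (toSite r) cE cVH cΛ i)) (unitM (sfStep Lc i)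
              (smStep 3 Lc i) (M1At 3 Lc (toSite r) cΛ i)) (W2SymOfK (unitK (sfStep Lc i) (smStep 3 Lc i) (KInvStep (d := 3) Lc i)) Lc (unitS (sfStep Lc i) (smStep 3 Lc i) (SpureRecAt 3 Lc (toSite r) cE cVH cΛ i)) (unitM (sfStep Lc i)
              (smStep 3 Lc i) (M1At 3 Lc (toSite r) cΛ i)) 0 (unitM₂ (sfStep Lc i) (smStep 3 Lc i) (M2Of 3 Lc (mixFFAt (toSite r) Lc) i))) κ (u + (Lc : ℤ) • t) κ' (u' + (Lc : ℤ) • t)) + cB • vh₂S κ (u + (Lc : ℤ) • t) κ' (u' + (Lc : ℤ)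
              • t) =
        shiftK (-((Lc : ℤ) • t)) ((cE₂ * (Lc : ℝ) ^ (2 * (3 + 1))) • mmRead Lc (K3OfK (unitK (sfStep Lc i) (smStep 3 Lc i) (KInvStep (d := 3) Lc i)) Lc (unitS (sfStep Lc i) (smStep 3 Lc i) (SpureRecAt 3 Lc (toSite r) cE cVH cΛ i))
            (unitM (sfStep Lc i) (smStep 3 Lc i) (M1At 3 Lc (toSite r) cΛ i)) (W2SymOfK (unitK (sfStep Lc i) (smStep 3 Lc i) (KInvStep (d := 3) Lc i)) Lc (unitS (sfStep Lc i) (smStep 3 Lc i) (SpureRecAt 3 Lc (toSite r) cE cVH cΛ i))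
            (unitM (sfStep Lc i) (smStep 3 Lc i) (M1At 3 Lc (toSite r) cΛ i)) 0 (unitM₂ (sfStep Lc i) (smStep 3 Lc i) (M2Of 3 Lc (mixFFAt (toSite r) Lc) i))) κ u κ' u') + cB • vh₂S κ u κ' u')) ∧
      (∀ κ κ' κ₁ κ₂,
        zmode Lc (fun κ u κ' u' => (cE₂ * (Lc : ℝ) ^ (2 * (3 + 1))) • mmRead Lc (K3OfK (unitK (sfStep Lc i) (smStep 3 Lc i) (KInvStep (d := 3) Lc i)) Lc (unitS (sfStep Lc i) (smStep 3 Lc i) (SpureRecAt 3 Lc (toSite r) cE cVH cΛ i))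
            (unitM (sfStep Lc i) (smStep 3 Lc i) (M1At 3 Lc (toSite r) cΛ i)) (W2SymOfK (unitK (sfStep Lc i) (smStep 3 Lc i) (KInvStep (d := 3) Lc i)) Lc (unitS (sfStep Lc i) (smStep 3 Lc i) (SpureRecAt 3 Lc (toSite r) cE cVH cΛ i))
            (unitM (sfStep Lc i) (smStep 3 Lc i) (M1At 3 Lc (toSite r) cΛ i)) 0 (unitM₂ (sfStep Lc i) (smStep 3 Lc i) (M2Of 3 Lc (mixFFAt (toSite r) Lc) i))) κ u κ' u') + cB • vh₂S κ u κ' u') κ κ' (Sum.inl κ₁) (Sum.inl κ₂) +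
        zmode Lc (fun κ u κ' u' => (cE₂ * (Lc : ℝ) ^ (2 * (3 + 1))) • mmRead Lc (K3OfK (unitK (sfStep Lc i) (smStep 3 Lc i) (KInvStep (d := 3) Lc i)) Lc (unitS (sfStep Lc i) (smStep 3 Lc i) (SpureRecAt 3 Lc (toSite r) cE cVH cΛ i))
            (unitM (sfStep Lc i) (smStep 3 Lc i) (M1At 3 Lc (toSite r) cΛ i)) (W2SymOfK (unitK (sfStep Lc i) (smStep 3 Lc i) (KInvStep (d := 3) Lc i)) Lc (unitS (sfStep Lc i) (smStep 3 Lc i) (SpureRecAt 3 Lc (toSite r) cE cVH cΛ i))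
            (unitM (sfStep Lc i) (smStep 3 Lc i) (M1At 3 Lc (toSite r) cΛ i)) 0 (unitM₂ (sfStep Lc i) (smStep 3 Lc i) (M2Of 3 Lc (mixFFAt (toSite r) Lc) i))) κ u κ' u') + cB • vh₂S κ u κ' u') κ' κ (Sum.inl κ₁) (Sum.inl κ₂) = 0)) :
    ∃ c ϑ δ : ℝ, 0 ≤ c ∧ 0 < ϑ ∧ ϑ < 1 ∧ 0 < δ ∧
      (∀ n : ℕ, LocStencil₂ (fun κ u κ' u' => unitS₂ (sfStep Lc (n + 1)) (smStep 3 Lc (n + 1)) (T2RecOf 3 Lc (fun j => KInvStep (d := 3) Lc j) (SpureRecAt 3 Lc (toSite r) cE cVH cΛ) (M1At 3 Lc (toSite r) cΛ) cE₂ cB Tc vh₂S (mixFFAt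
          (toSite r) Lc) (n + 1)) κ u κ' u' - unitS₂ (sfStep Lc n) (smStep 3 Lc n) (T2RecOf 3 Lc (fun j => KInvStep (d := 3) Lc j) (SpureRecAt 3 Lc (toSite r) cE cVH cΛ) (M1At 3 Lc (toSite r) cΛ) cE₂ cB Tc vh₂S (mixFFAt (toSite r) Lc)
          n) κ u κ' u') (c * ϑ ^ n) δ) ∧
      (∀ k j : ℕ, LocStencil₂ (fun κ u κ' u' => unitS₂ (sfStep Lc (k + j)) (smStep 3 Lc (k + j)) (T2RecOf 3 Lc (fun j => KInvStep (d := 3) Lc j) (SpureRecAt 3 Lc (toSite r) cE cVH cΛ) (M1At 3 Lc (toSite r) cΛ) cE₂ cB Tc vh₂S (mixFFAt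
          (toSite r) Lc) (k + j)) κ u κ' u' - unitS₂ (sfStep Lc k) (smStep 3 Lc k) (T2RecOf 3 Lc (fun j => KInvStep (d := 3) Lc j) (SpureRecAt 3 Lc (toSite r) cE cVH cΛ) (M1At 3 Lc (toSite r) cΛ) cE₂ cB Tc vh₂S (mixFFAt (toSite r) Lc)
          k) κ u κ' u') (c * (1 - ϑ)⁻¹ * ϑ ^ k) δ) ∧
      (∀ (n : ℕ) κ u κ' u' x z a b, |unitS₂ (sfStep Lc (n + 1)) (smStep 3 Lc (n + 1)) (T2RecOf 3 Lc (fun j => KInvStep (d := 3) Lc j) (SpureRecAt 3 Lc (toSite r) cE cVH cΛ) (M1At 3 Lc (toSite r) cΛ) cE₂ cB Tc vh₂S (mixFFAt (toSite r)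
          Lc) (n + 1)) κ u κ' u' x z a b - unitS₂ (sfStep Lc n) (smStep 3 Lc n) (T2RecOf 3 Lc (fun j => KInvStep (d := 3) Lc j) (SpureRecAt 3 Lc (toSite r) cE cVH cΛ) (M1At 3 Lc (toSite r) cΛ) cE₂ cB Tc vh₂S (mixFFAt (toSite r) Lc) n)
          κ u κ' u' x z a b| ≤ c * ϑ ^ n) := by
  have hLc1 : 1 ≤ Lc := by omega
  have hpin : |cE₂| ≤ (Lc : ℝ) ^ (2 * (3 + 1)) := by rw [hpinEq, abs_of_nonneg (by positivity)]
  have hBex : ∃ C δ : ℝ, 0 < δ ∧ LocStencil₂ vh₂S C δ := ⟨CB, δB, hδB, hB⟩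
  -- row (U): «T2Shape» of the reference tower from F2a-comb — (B)
  obtain ⟨C₂, δ₂, hδ₂, hT⟩ := t2Shape_undressedComb_three_of_F2a hLc hr hcE cVH cΛ cE₂ cB Tc hBff hBmm hB hδB hpin hZ
  have hC₂ : 0 ≤ C₂ := (hT 0).nonneg
  -- (F4b): the sources' Cauchy row of the reference tower, hypothesis-free — (B) §0 ((A) ∘ the OWNER's Final)
  obtain ⟨-, cb, θb, δb, hcb, hθb0, hθb1, hδb, hball⟩ := source_rows_three_holds (r := r) hLc hcE cVH cΛ cE₂ cB hB hδB hr
  -- the K-slot of record (road P1), both rows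
  obtain ⟨CK, δK, cK, θK, hδK, hθK0, hθK1, hK, hKall⟩ := convCKWall_holds (Lc := Lc) hLc
  -- (F4b) `hf`: the forcing's geometric `LocStencil₂` bound
  obtain ⟨cf, θf, δf, hcf, hθf0, hθf1, hδf, hf⟩ := hf_of_shapes (d := 3) (r := r) hLc1 cE cVH cΛ cE₂ cB Tc (vh₂S := vh₂S)
    (fun j => hK j) (fun k j => hKall k j) hδK hθK0 hθK1 hT hδ₂ hcb hθb0 hθb1 hδb (fun k => hball k 1)
  -- (F2b) `hZf` and (F4d) `hZ0` ∕ `h0`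
  have hZf := fun m => hZf_of_hZ (d := 3) (r := r) hLc1 hr cE cVH cΛ cE₂ cB Tc hBff hBmm hBex hBt hZ m
  have hZ0 := hZ0_symZ_of_pinEq (d := 3) (r := r) hLc1 hr cE cVH cΛ cE₂ cB Tc hBff hBmm hBex hBt (by rw [hpinEq]) (fun κ κ' κ₁ κ₂ => (hZ 0).2 κ κ' κ₁ κ₂)
  have h0 : LocStencil₂ (fun κ u κ' u' => unitS₂ (sfStep Lc 1) (smStep 3 Lc 1) (T2RecOf 3 Lc (fun j => KInvStep (d := 3) Lc j) (SpureRecAt 3 Lc (toSite r) cE cVH cΛ) (M1At 3 Lc (toSite r) cΛ) cE₂ cB Tc vh₂S (mixFFAt (toSite r) Lc) 1)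
      κ u κ' u' - unitS₂ (sfStep Lc 0) (smStep 3 Lc 0) (T2RecOf 3 Lc (fun j => KInvStep (d := 3) Lc j) (SpureRecAt 3 Lc (toSite r) cE cVH cΛ) (M1At 3 Lc (toSite r) cΛ) cE₂ cB Tc vh₂S (mixFFAt (toSite r) Lc) 0) κ u κ' u') (C₂ + |(-1 :
      ℝ)| * C₂) (min δf δ₂) :=
    (locStencil₂_sub (hT 1) (hT 0)).mono (min_le_right _ _)
  -- (F1b) the difference tower unrolled through the shifted UNDRESSED transport — gan24-p2
  have hsplit := fun n : ℕ => unitS₂_T2RecOf_sub_eq_transport_add_sum (fun j => KInvStep (d := 3) Lc j) (SpureRecAt 3 Lc (toSite r) cE cVH cΛ)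
    (M1At 3 Lc (toSite r) cΛ) cE₂ cB Tc vh₂S (mixFFAt (toSite r) Lc) hBff hBmm
    (step_data_of_letters (fun j => KInvStep (d := 3) Lc j) (SpureRecAt 3 Lc (toSite r) cE cVH cΛ) (M1At 3 Lc (toSite r) cΛ) cE₂ cB Tc hLc1
      (fun j => decays_KInvStep (d := 3) (Lc := Lc) j) (fun j => locStencil_SpureRecAt hLc1 hr cE cVH cΛ j)
      (fun j => ⟨_, 1, one_pos, vertexFamily_M1At hLc1 hr cΛ j zero_le_one⟩) hBex (hmix_an1 hLc1 hr))
    (bdd₄_unitS₂_T2RecOf_of_letters (fun j => KInvStep (d := 3) Lc j) (SpureRecAt 3 Lc (toSite r) cE cVH cΛ) (M1At 3 Lc (toSite r) cΛ) cE₂ cB Tc hLc1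
      (fun j => decays_KInvStep (d := 3) (Lc := Lc) j) (fun j => locStencil_SpureRecAt hLc1 hr cE cVH cΛ j)
      (fun j => ⟨_, 1, one_pos, vertexFamily_M1At hLc1 hr cΛ j zero_le_one⟩) hBex (hmix_an1 hLc1 hr)) n
  -- END #2 with F3b inside
  obtain ⟨c, ϑ, δT, hc, hϑ0, hϑ1, hδT, -, hD⟩ := rate_three_of_rows_F3b (Lc := Lc) hLc hK hδK cE₂
    (fun n => (fun κ u κ' u' => unitS₂ (sfStep Lc (n + 1)) (smStep 3 Lc (n + 1)) (T2RecOf 3 Lc (fun j => KInvStep (d := 3) Lc j) (SpureRecAt 3 Lc (toSite r) cE cVH cΛ) (M1At 3 Lc (toSite r) cΛ) cE₂ cB Tc vh₂S (mixFFAt (toSite r) Lc)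
        (n + 1)) κ u κ' u' - unitS₂ (sfStep Lc n) (smStep 3 Lc n) (T2RecOf 3 Lc (fun j => KInvStep (d := 3) Lc j) (SpureRecAt 3 Lc (toSite r) cE cVH cΛ) (M1At 3 Lc (toSite r) cΛ) cE₂ cB Tc vh₂S (mixFFAt (toSite r) Lc) n) κ u κ' u'))
    (fun m => ((lin4 (cE₂ * (Lc : ℝ) ^ (2 * (3 + 1))) (unitK (sfStep Lc (m + 1)) (smStep 3 Lc (m + 1)) (KInvStep (d := 3) Lc (m + 1))) Lc (unitS₂ (sfStep Lc m) (smStep 3 Lc m) (T2RecOf 3 Lc (fun j => KInvStep (d := 3) Lc j)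
        (SpureRecAt 3 Lc (toSite r) cE cVH cΛ) (M1At 3 Lc (toSite r) cΛ) cE₂ cB Tc vh₂S (mixFFAt (toSite r) Lc) m)) - lin4 (cE₂ * (Lc : ℝ) ^ (2 * (3 + 1))) (unitK (sfStep Lc m) (smStep 3 Lc m) (KInvStep (d := 3) Lc m)) Lc (unitS₂
        (sfStep Lc m) (smStep 3 Lc m) (T2RecOf 3 Lc (fun j => KInvStep (d := 3) Lc j) (SpureRecAt 3 Lc (toSite r) cE cVH cΛ) (M1At 3 Lc (toSite r) cΛ) cE₂ cB Tc vh₂S (mixFFAt (toSite r) Lc) m))) + ((fun κ u κ' u' => (cE₂ * (Lc : ℝ) ^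
        (2 * (3 + 1))) • mmRead Lc (K3OfK (unitK (sfStep Lc (m + 1)) (smStep 3 Lc (m + 1)) (KInvStep (d := 3) Lc (m + 1))) Lc (unitS (sfStep Lc (m + 1)) (smStep 3 Lc (m + 1)) (SpureRecAt 3 Lc (toSite r) cE cVH cΛ (m + 1))) (unitM
        (sfStep Lc (m + 1)) (smStep 3 Lc (m + 1)) (M1At 3 Lc (toSite r) cΛ (m + 1))) (W2SymOfK (unitK (sfStep Lc (m + 1)) (smStep 3 Lc (m + 1)) (KInvStep (d := 3) Lc (m + 1))) Lc (unitS (sfStep Lc (m + 1)) (smStep 3 Lc (m + 1))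
        (SpureRecAt 3 Lc (toSite r) cE cVH cΛ (m + 1))) (unitM (sfStep Lc (m + 1)) (smStep 3 Lc (m + 1)) (M1At 3 Lc (toSite r) cΛ (m + 1))) 0 (unitM₂ (sfStep Lc (m + 1)) (smStep 3 Lc (m + 1)) (M2Of 3 Lc (mixFFAt (toSite r) Lc) (m +
        1)))) κ u κ' u') + cB • vh₂S κ u κ' u') - (fun κ u κ' u' => (cE₂ * (Lc : ℝ) ^ (2 * (3 + 1))) • mmRead Lc (K3OfK (unitK (sfStep Lc m) (smStep 3 Lc m) (KInvStep (d := 3) Lc m)) Lc (unitS (sfStep Lc m) (smStep 3 Lc m) (SpureRecAt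
        3 Lc (toSite r) cE cVH cΛ m)) (unitM (sfStep Lc m) (smStep 3 Lc m) (M1At 3 Lc (toSite r) cΛ m)) (W2SymOfK (unitK (sfStep Lc m) (smStep 3 Lc m) (KInvStep (d := 3) Lc m)) Lc (unitS (sfStep Lc m) (smStep 3 Lc m) (SpureRecAt 3 Lc
        (toSite r) cE cVH cΛ m)) (unitM (sfStep Lc m) (smStep 3 Lc m) (M1At 3 Lc (toSite r) cΛ m)) 0 (unitM₂ (sfStep Lc m) (smStep 3 Lc m) (M2Of 3 Lc (mixFFAt (toSite r) Lc) m))) κ u κ' u') + cB • vh₂S κ u κ' u'))))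
    (fun _ => (0 : ℝ)) (lt_min hδf hδ₂) hθf0 hθf1 hpin hsplit (fun m => ⟨(hf m).mono (min_le_left _ _), by positivity⟩) hZf ⟨h0, by positivity⟩ hZ0
  exact ⟨c, ϑ, δT, hc, hϑ0, hϑ1, hδT, hD,
    fun k j => cauchy_of_rate (fun n => unitS₂ (sfStep Lc n) (smStep 3 Lc n) (T2RecOf 3 Lc (fun j => KInvStep (d := 3) Lc j) (SpureRecAt 3 Lc (toSite r) cE cVH cΛ) (M1At 3 Lc (toSite r) cΛ) cE₂ cB Tc vh₂S (mixFFAt (toSite r) Lc) n))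
        hc hϑ0.le hϑ1 hD k j,
    fun n κ u κ' u' x z a b => sup_of_locStencil₂ hδT.le (hD n) κ u κ' u' x z a b⟩

/-- NOT IN PRINT; OUR BOOKKEEPING — **THE OWNER's `hU` QUINTUPLE**: the one-step clause of §1 in the `Pi` spelling `T (n+1) − T n` and with the weak inequality
`0 ≤ ϑU`, i.e. LITERALLY the binders `(hU) (hcU) (hϑU0) (hϑU1) (hδU)` of the OWNER gan24-p1's generic `T2DeviationDrift.drift_of_dev_rows` at `T := fun n ↦ T_n`
(the undressed-kernel comb-slot reference tower), from F2a-comb and the exact pin. -/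
theorem exists_hU_three_of_F2a_pinEq (hLc : 2 ≤ Lc) (hr : r ∈ box (3 + 1) Lc) {cE : ℝ} (hcE : cE = (Lc : ℝ) ^ (3 + 1)) (cVH cΛ cE₂ cB : ℝ)
    (Tc : Fin 4 → Fin 4 → Fin 4 → Fin 4 → ℝ) {vh₂S : Tab 3}
    (hBff : ∀ κ u κ' u' x z (α β : Fin (3 + 1)), vh₂S κ u κ' u' x z (Sum.inl α) (Sum.inl β) = 0)
    (hBmm : ∀ κ u κ' u' x z (μ ν : Fin (3 + 1)), vh₂S κ u κ' u' x z (Sum.inr μ) (Sum.inr ν) = 0)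
    {CB δB : ℝ} (hB : LocStencil₂ vh₂S CB δB) (hδB : 0 < δB)
    (hBt : ∀ (κ : Fin (3 + 1)) (u : Fin (3 + 1) → ℤ) (κ' : Fin (3 + 1)) (u' t : Fin (3 + 1) → ℤ),
      vh₂S κ (u + (Lc : ℤ) • t) κ' (u' + (Lc : ℤ) • t) = shiftK (-((Lc : ℤ) • t)) (vh₂S κ u κ' u'))
    (hpinEq : cE₂ = (Lc : ℝ) ^ (2 * (3 + 1)))
    (hZ : ∀ i : ℕ,
      (∀ κ u κ' u' t,
          (cE₂ * (Lc : ℝ) ^ (2 * (3 + 1))) • mmRead Lc (K3OfK (unitK (sfStep Lc i) (smStep 3 Lc i) (KInvStep (d := 3) Lc i)) Lc (unitS (sfStep Lc i) (smStep 3 Lc i) (SpureRecAt 3 Lc (toSite r) cE cVH cΛ i)) (unitM (sfStep Lc i)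
              (smStep 3 Lc i) (M1At 3 Lc (toSite r) cΛ i)) (W2SymOfK (unitK (sfStep Lc i) (smStep 3 Lc i) (KInvStep (d := 3) Lc i)) Lc (unitS (sfStep Lc i) (smStep 3 Lc i) (SpureRecAt 3 Lc (toSite r) cE cVH cΛ i)) (unitM (sfStep Lc i)
              (smStep 3 Lc i) (M1At 3 Lc (toSite r) cΛ i)) 0 (unitM₂ (sfStep Lc i) (smStep 3 Lc i) (M2Of 3 Lc (mixFFAt (toSite r) Lc) i))) κ (u + (Lc : ℤ) • t) κ' (u' + (Lc : ℤ) • t)) + cB • vh₂S κ (u + (Lc : ℤ) • t) κ' (u' + (Lc : ℤ)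
              • t) =
        shiftK (-((Lc : ℤ) • t)) ((cE₂ * (Lc : ℝ) ^ (2 * (3 + 1))) • mmRead Lc (K3OfK (unitK (sfStep Lc i) (smStep 3 Lc i) (KInvStep (d := 3) Lc i)) Lc (unitS (sfStep Lc i) (smStep 3 Lc i) (SpureRecAt 3 Lc (toSite r) cE cVH cΛ i))
            (unitM (sfStep Lc i) (smStep 3 Lc i) (M1At 3 Lc (toSite r) cΛ i)) (W2SymOfK (unitK (sfStep Lc i) (smStep 3 Lc i) (KInvStep (d := 3) Lc i)) Lc (unitS (sfStep Lc i) (smStep 3 Lc i) (SpureRecAt 3 Lc (toSite r) cE cVH cΛ i))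
            (unitM (sfStep Lc i) (smStep 3 Lc i) (M1At 3 Lc (toSite r) cΛ i)) 0 (unitM₂ (sfStep Lc i) (smStep 3 Lc i) (M2Of 3 Lc (mixFFAt (toSite r) Lc) i))) κ u κ' u') + cB • vh₂S κ u κ' u')) ∧
      (∀ κ κ' κ₁ κ₂,
        zmode Lc (fun κ u κ' u' => (cE₂ * (Lc : ℝ) ^ (2 * (3 + 1))) • mmRead Lc (K3OfK (unitK (sfStep Lc i) (smStep 3 Lc i) (KInvStep (d := 3) Lc i)) Lc (unitS (sfStep Lc i) (smStep 3 Lc i) (SpureRecAt 3 Lc (toSite r) cE cVH cΛ i))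
            (unitM (sfStep Lc i) (smStep 3 Lc i) (M1At 3 Lc (toSite r) cΛ i)) (W2SymOfK (unitK (sfStep Lc i) (smStep 3 Lc i) (KInvStep (d := 3) Lc i)) Lc (unitS (sfStep Lc i) (smStep 3 Lc i) (SpureRecAt 3 Lc (toSite r) cE cVH cΛ i))
            (unitM (sfStep Lc i) (smStep 3 Lc i) (M1At 3 Lc (toSite r) cΛ i)) 0 (unitM₂ (sfStep Lc i) (smStep 3 Lc i) (M2Of 3 Lc (mixFFAt (toSite r) Lc) i))) κ u κ' u') + cB • vh₂S κ u κ' u') κ κ' (Sum.inl κ₁) (Sum.inl κ₂) +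
        zmode Lc (fun κ u κ' u' => (cE₂ * (Lc : ℝ) ^ (2 * (3 + 1))) • mmRead Lc (K3OfK (unitK (sfStep Lc i) (smStep 3 Lc i) (KInvStep (d := 3) Lc i)) Lc (unitS (sfStep Lc i) (smStep 3 Lc i) (SpureRecAt 3 Lc (toSite r) cE cVH cΛ i))
            (unitM (sfStep Lc i) (smStep 3 Lc i) (M1At 3 Lc (toSite r) cΛ i)) (W2SymOfK (unitK (sfStep Lc i) (smStep 3 Lc i) (KInvStep (d := 3) Lc i)) Lc (unitS (sfStep Lc i) (smStep 3 Lc i) (SpureRecAt 3 Lc (toSite r) cE cVH cΛ i))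
            (unitM (sfStep Lc i) (smStep 3 Lc i) (M1At 3 Lc (toSite r) cΛ i)) 0 (unitM₂ (sfStep Lc i) (smStep 3 Lc i) (M2Of 3 Lc (mixFFAt (toSite r) Lc) i))) κ u κ' u') + cB • vh₂S κ u κ' u') κ' κ (Sum.inl κ₁) (Sum.inl κ₂) = 0)) :
    ∃ cU ϑU δU : ℝ, 0 ≤ cU ∧ 0 ≤ ϑU ∧ ϑU < 1 ∧ 0 < δU ∧
      ∀ n : ℕ, LocStencil₂ ((fun n : ℕ => unitS₂ (sfStep Lc n) (smStep 3 Lc n) (T2RecOf 3 Lc (fun j => KInvStep (d := 3) Lc j) (SpureRecAt 3 Lc (toSite r) cE cVH cΛ) (M1At 3 Lc (toSite r) cΛ) cE₂ cB Tc vh₂S (mixFFAt (toSite r) Lc) n))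
          (n + 1) - (fun n : ℕ => unitS₂ (sfStep Lc n) (smStep 3 Lc n) (T2RecOf 3 Lc (fun j => KInvStep (d := 3) Lc j) (SpureRecAt 3 Lc (toSite r) cE cVH cΛ) (M1At 3 Lc (toSite r) cΛ) cE₂ cB Tc vh₂S (mixFFAt (toSite r) Lc) n)) n) (cU
          * ϑU ^ n) δU := by
  obtain ⟨c, ϑ, δ, hc, hϑ0, hϑ1, hδ, hD, -, -⟩ := t2Drift_undressedComb_three_of_F2a_pinEq hLc hr hcE cVH cΛ cE₂ cB Tc hBff hBmm hB hδB hBt hpinEq hZ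
  exact ⟨c, ϑ, δ, hc, hϑ0.le, hϑ1, hδ, hD⟩

/-! ## §2 At road FP's literal of record -/

/-- NOT IN PRINT; OUR PROOF ATTEMPT — **ROW (U-drift) AT THE LITERAL's DATA**: `ρ_c = toSite (ctrOff (3+1) Lc)`, `(cE, cVH, cΛ, cE₂, cB) = (Lc⁴, −Lc⁸∕2, 2∕Lc⁴, Lc⁸, −Lc¹²∕4)`
(the exact pin MET), `Tc := (8N²)⁻¹ • wsym22 N`, `vh₂S := vh₂SAn1 Lc` (`vh₂SAn1_inl_inl` ∕ `_inr_inr`, K-P's `locStencil₂_vh₂SAn1` at odd `Lc`, `vh₂SAn1_translate`): «T2Drift» of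
the reference tower from F2a-comb ALONE. -/
theorem t2Drift_undressedComb_literal_of_F2a (hodd : Odd Lc) (hLc : 2 ≤ Lc) (N : ℕ)
    (hZ : ∀ i : ℕ,
      (∀ κ u κ' u' t,
          (((Lc : ℝ) ^ 8) * (Lc : ℝ) ^ (2 * (3 + 1))) • mmRead Lc (K3OfK (unitK (sfStep Lc i) (smStep 3 Lc i) (KInvStep (d := 3) Lc i)) Lc (unitS (sfStep Lc i) (smStep 3 Lc i) (SpureRecAt 3 Lc (toSite (ctrOff (3 + 1) Lc)) ((Lc : ℝ) ^
              4) (-((Lc : ℝ) ^ 8 / 2)) (2 / (Lc : ℝ) ^ 4) i)) (unitM (sfStep Lc i) (smStep 3 Lc i) (M1At 3 Lc (toSite (ctrOff (3 + 1) Lc)) (2 / (Lc : ℝ) ^ 4) i)) (W2SymOfK (unitK (sfStep Lc i) (smStep 3 Lc i) (KInvStep (d := 3) Lc i))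
              Lc (unitS (sfStep Lc i) (smStep 3 Lc i) (SpureRecAt 3 Lc (toSite (ctrOff (3 + 1) Lc)) ((Lc : ℝ) ^ 4) (-((Lc : ℝ) ^ 8 / 2)) (2 / (Lc : ℝ) ^ 4) i)) (unitM (sfStep Lc i) (smStep 3 Lc i) (M1At 3 Lc (toSite (ctrOff (3 + 1)
              Lc)) (2 / (Lc : ℝ) ^ 4) i)) 0 (unitM₂ (sfStep Lc i) (smStep 3 Lc i) (M2Of 3 Lc (mixFFAt (toSite (ctrOff (3 + 1) Lc)) Lc) i))) κ (u + (Lc : ℤ) • t) κ' (u' + (Lc : ℤ) • t)) + (-((Lc : ℝ) ^ 12 / 4)) • vh₂SAn1 Lc κ (u + (Lc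
              : ℤ) • t) κ' (u' + (Lc : ℤ) • t) =
        shiftK (-((Lc : ℤ) • t)) ((((Lc : ℝ) ^ 8) * (Lc : ℝ) ^ (2 * (3 + 1))) • mmRead Lc (K3OfK (unitK (sfStep Lc i) (smStep 3 Lc i) (KInvStep (d := 3) Lc i)) Lc (unitS (sfStep Lc i) (smStep 3 Lc i) (SpureRecAt 3 Lc (toSite (ctrOff
            (3 + 1) Lc)) ((Lc : ℝ) ^ 4) (-((Lc : ℝ) ^ 8 / 2)) (2 / (Lc : ℝ) ^ 4) i)) (unitM (sfStep Lc i) (smStep 3 Lc i) (M1At 3 Lc (toSite (ctrOff (3 + 1) Lc)) (2 / (Lc : ℝ) ^ 4) i)) (W2SymOfK (unitK (sfStep Lc i) (smStep 3 Lc i)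
            (KInvStep (d := 3) Lc i)) Lc (unitS (sfStep Lc i) (smStep 3 Lc i) (SpureRecAt 3 Lc (toSite (ctrOff (3 + 1) Lc)) ((Lc : ℝ) ^ 4) (-((Lc : ℝ) ^ 8 / 2)) (2 / (Lc : ℝ) ^ 4) i)) (unitM (sfStep Lc i) (smStep 3 Lc i) (M1At 3 Lc
            (toSite (ctrOff (3 + 1) Lc)) (2 / (Lc : ℝ) ^ 4) i)) 0 (unitM₂ (sfStep Lc i) (smStep 3 Lc i) (M2Of 3 Lc (mixFFAt (toSite (ctrOff (3 + 1) Lc)) Lc) i))) κ u κ' u') + (-((Lc : ℝ) ^ 12 / 4)) • vh₂SAn1 Lc κ u κ' u')) ∧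
      (∀ κ κ' κ₁ κ₂,
        zmode Lc (fun κ u κ' u' => (((Lc : ℝ) ^ 8) * (Lc : ℝ) ^ (2 * (3 + 1))) • mmRead Lc (K3OfK (unitK (sfStep Lc i) (smStep 3 Lc i) (KInvStep (d := 3) Lc i)) Lc (unitS (sfStep Lc i) (smStep 3 Lc i) (SpureRecAt 3 Lc (toSite (ctrOff
            (3 + 1) Lc)) ((Lc : ℝ) ^ 4) (-((Lc : ℝ) ^ 8 / 2)) (2 / (Lc : ℝ) ^ 4) i)) (unitM (sfStep Lc i) (smStep 3 Lc i) (M1At 3 Lc (toSite (ctrOff (3 + 1) Lc)) (2 / (Lc : ℝ) ^ 4) i)) (W2SymOfK (unitK (sfStep Lc i) (smStep 3 Lc i)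
            (KInvStep (d := 3) Lc i)) Lc (unitS (sfStep Lc i) (smStep 3 Lc i) (SpureRecAt 3 Lc (toSite (ctrOff (3 + 1) Lc)) ((Lc : ℝ) ^ 4) (-((Lc : ℝ) ^ 8 / 2)) (2 / (Lc : ℝ) ^ 4) i)) (unitM (sfStep Lc i) (smStep 3 Lc i) (M1At 3 Lc
            (toSite (ctrOff (3 + 1) Lc)) (2 / (Lc : ℝ) ^ 4) i)) 0 (unitM₂ (sfStep Lc i) (smStep 3 Lc i) (M2Of 3 Lc (mixFFAt (toSite (ctrOff (3 + 1) Lc)) Lc) i))) κ u κ' u') + (-((Lc : ℝ) ^ 12 / 4)) • vh₂SAn1 Lc κ u κ' u') κ κ'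
            (Sum.inl κ₁) (Sum.inl κ₂) +
        zmode Lc (fun κ u κ' u' => (((Lc : ℝ) ^ 8) * (Lc : ℝ) ^ (2 * (3 + 1))) • mmRead Lc (K3OfK (unitK (sfStep Lc i) (smStep 3 Lc i) (KInvStep (d := 3) Lc i)) Lc (unitS (sfStep Lc i) (smStep 3 Lc i) (SpureRecAt 3 Lc (toSite (ctrOff
            (3 + 1) Lc)) ((Lc : ℝ) ^ 4) (-((Lc : ℝ) ^ 8 / 2)) (2 / (Lc : ℝ) ^ 4) i)) (unitM (sfStep Lc i) (smStep 3 Lc i) (M1At 3 Lc (toSite (ctrOff (3 + 1) Lc)) (2 / (Lc : ℝ) ^ 4) i)) (W2SymOfK (unitK (sfStep Lc i) (smStep 3 Lc i)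
            (KInvStep (d := 3) Lc i)) Lc (unitS (sfStep Lc i) (smStep 3 Lc i) (SpureRecAt 3 Lc (toSite (ctrOff (3 + 1) Lc)) ((Lc : ℝ) ^ 4) (-((Lc : ℝ) ^ 8 / 2)) (2 / (Lc : ℝ) ^ 4) i)) (unitM (sfStep Lc i) (smStep 3 Lc i) (M1At 3 Lc
            (toSite (ctrOff (3 + 1) Lc)) (2 / (Lc : ℝ) ^ 4) i)) 0 (unitM₂ (sfStep Lc i) (smStep 3 Lc i) (M2Of 3 Lc (mixFFAt (toSite (ctrOff (3 + 1) Lc)) Lc) i))) κ u κ' u') + (-((Lc : ℝ) ^ 12 / 4)) • vh₂SAn1 Lc κ u κ' u') κ' κ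
            (Sum.inl κ₁) (Sum.inl κ₂) = 0)) :
    ∃ c ϑ δ : ℝ, 0 ≤ c ∧ 0 < ϑ ∧ ϑ < 1 ∧ 0 < δ ∧
      (∀ n : ℕ, LocStencil₂ (fun κ u κ' u' => unitS₂ (sfStep Lc (n + 1)) (smStep 3 Lc (n + 1)) (T2RecOf 3 Lc (fun j => KInvStep (d := 3) Lc j) (SpureRecAt 3 Lc (toSite (ctrOff (3 + 1) Lc)) ((Lc : ℝ) ^ 4) (-((Lc : ℝ) ^ 8 / 2)) (2 / (Lc
          : ℝ) ^ 4)) (M1At 3 Lc (toSite (ctrOff (3 + 1) Lc)) (2 / (Lc : ℝ) ^ 4)) ((Lc : ℝ) ^ 8) (-((Lc : ℝ) ^ 12 / 4)) ((8 * (N : ℝ) ^ 2)⁻¹ • wsym22 N) (vh₂SAn1 Lc) (mixFFAt (toSite (ctrOff (3 + 1) Lc)) Lc) (n + 1)) κ u κ' u' - unitS₂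
          (sfStep Lc n) (smStep 3 Lc n) (T2RecOf 3 Lc (fun j => KInvStep (d := 3) Lc j) (SpureRecAt 3 Lc (toSite (ctrOff (3 + 1) Lc)) ((Lc : ℝ) ^ 4) (-((Lc : ℝ) ^ 8 / 2)) (2 / (Lc : ℝ) ^ 4)) (M1At 3 Lc (toSite (ctrOff (3 + 1) Lc)) (2
          / (Lc : ℝ) ^ 4)) ((Lc : ℝ) ^ 8) (-((Lc : ℝ) ^ 12 / 4)) ((8 * (N : ℝ) ^ 2)⁻¹ • wsym22 N) (vh₂SAn1 Lc) (mixFFAt (toSite (ctrOff (3 + 1) Lc)) Lc) n) κ u κ' u') (c * ϑ ^ n) δ) ∧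
      (∀ k j : ℕ, LocStencil₂ (fun κ u κ' u' => unitS₂ (sfStep Lc (k + j)) (smStep 3 Lc (k + j)) (T2RecOf 3 Lc (fun j => KInvStep (d := 3) Lc j) (SpureRecAt 3 Lc (toSite (ctrOff (3 + 1) Lc)) ((Lc : ℝ) ^ 4) (-((Lc : ℝ) ^ 8 / 2)) (2 /
          (Lc : ℝ) ^ 4)) (M1At 3 Lc (toSite (ctrOff (3 + 1) Lc)) (2 / (Lc : ℝ) ^ 4)) ((Lc : ℝ) ^ 8) (-((Lc : ℝ) ^ 12 / 4)) ((8 * (N : ℝ) ^ 2)⁻¹ • wsym22 N) (vh₂SAn1 Lc) (mixFFAt (toSite (ctrOff (3 + 1) Lc)) Lc) (k + j)) κ u κ' u' -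
          unitS₂ (sfStep Lc k) (smStep 3 Lc k) (T2RecOf 3 Lc (fun j => KInvStep (d := 3) Lc j) (SpureRecAt 3 Lc (toSite (ctrOff (3 + 1) Lc)) ((Lc : ℝ) ^ 4) (-((Lc : ℝ) ^ 8 / 2)) (2 / (Lc : ℝ) ^ 4)) (M1At 3 Lc (toSite (ctrOff (3 + 1)
          Lc)) (2 / (Lc : ℝ) ^ 4)) ((Lc : ℝ) ^ 8) (-((Lc : ℝ) ^ 12 / 4)) ((8 * (N : ℝ) ^ 2)⁻¹ • wsym22 N) (vh₂SAn1 Lc) (mixFFAt (toSite (ctrOff (3 + 1) Lc)) Lc) k) κ u κ' u') (c * (1 - ϑ)⁻¹ * ϑ ^ k) δ) ∧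
      (∀ (n : ℕ) κ u κ' u' x z a b, |unitS₂ (sfStep Lc (n + 1)) (smStep 3 Lc (n + 1)) (T2RecOf 3 Lc (fun j => KInvStep (d := 3) Lc j) (SpureRecAt 3 Lc (toSite (ctrOff (3 + 1) Lc)) ((Lc : ℝ) ^ 4) (-((Lc : ℝ) ^ 8 / 2)) (2 / (Lc : ℝ) ^
          4)) (M1At 3 Lc (toSite (ctrOff (3 + 1) Lc)) (2 / (Lc : ℝ) ^ 4)) ((Lc : ℝ) ^ 8) (-((Lc : ℝ) ^ 12 / 4)) ((8 * (N : ℝ) ^ 2)⁻¹ • wsym22 N) (vh₂SAn1 Lc) (mixFFAt (toSite (ctrOff (3 + 1) Lc)) Lc) (n + 1)) κ u κ' u' x z a b -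
          unitS₂ (sfStep Lc n) (smStep 3 Lc n) (T2RecOf 3 Lc (fun j => KInvStep (d := 3) Lc j) (SpureRecAt 3 Lc (toSite (ctrOff (3 + 1) Lc)) ((Lc : ℝ) ^ 4) (-((Lc : ℝ) ^ 8 / 2)) (2 / (Lc : ℝ) ^ 4)) (M1At 3 Lc (toSite (ctrOff (3 + 1)
          Lc)) (2 / (Lc : ℝ) ^ 4)) ((Lc : ℝ) ^ 8) (-((Lc : ℝ) ^ 12 / 4)) ((8 * (N : ℝ) ^ 2)⁻¹ • wsym22 N) (vh₂SAn1 Lc) (mixFFAt (toSite (ctrOff (3 + 1) Lc)) Lc) n) κ u κ' u' x z a b| ≤ c * ϑ ^ n) := by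
  obtain ⟨CB, δB, hδB, hB⟩ := locStencil₂_vh₂SAn1 hodd
  exact t2Drift_undressedComb_three_of_F2a_pinEq hLc (ctrOff_mem_box (by omega)) (cE := (Lc : ℝ) ^ 4) (by norm_num) _ _ _ _ _
    (fun κ u κ' u' x z α β => vh₂SAn1_inl_inl κ u κ' u' x z α β) (fun κ u κ' u' x z μ ν => vh₂SAn1_inr_inr κ u κ' u' x z μ ν) hB hδB
    (fun κ u κ' u' t => vh₂SAn1_translate (by omega) κ u κ' u' t) (by norm_num) hZ

end Summit.QuantumFields.BalabanUV.Beta.GAN24.T2UndressedCombDriftEnd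

end
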